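import Summits.ResolutionOfSingularities.ResolutionOfSingularities.Theorems.FrobeniusClosingSteerFreeChainBoundPBasis
import HarnessLib

/-!
# Crux `Steer` (stmt-ResolutionOfSingularities-16345), chain W4.1, hGW3 assembly: the free-chain bound AT A HORIZON — hypotheses on the first `M`
# steps only

OURS (campaign `res-hironaka`, rung L ★L-G4, slot W4.1; seat res-L0-w41-stub-2 g6; `hGW3-ASSEMBLY-MAP.md` d0970ee959ebaf4a §2 (A)/(K3ᴳ); RULING 251 (c)).
Theses-free, definition-free. The tree theorems `FreeChain.exists_coordinates` / `exists_telescope` (p540237), `FreeChainBound.exists_free_chain_data`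
(p545217) and `FreeChainBoundPBasis.milnorLengthPlus_completion_ge` (p551861) quantify FREENESS and RATIONALITY over ALL steps although the bound at
horizon `M` reads only the steps `< M`. The hGW3 assembler works horizon by horizon (a finite étale base change makes only finitely many centres rational),
so it needs the sharper forms below: same proofs, hypotheses `hfree` / `hrat` restricted to `m < M`. [folklore]

* `FreeChainHorizon.exists_sub_mem_maximalIdeal_of_rational_le`, `span_excParam_eq_of_free_le`, `exists_coordinates_lt`, `exists_telescope_lt`,
  `exists_free_chain_data_lt` — the bookkeeping at horizon `M`;
* `FreeChainHorizon.milnorLengthPlus_completion_ge_of_lt` — **`M − 1 ≤ ℓ(Ŝ₀ ⧸ 𝒥_abs f̂₀) < ∞` from freeness and rationality of the steps `< M` only**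
  (regularity, dimension, quadratic transforms, `𝔪_m S_{m+1} = (x m)` and the laws for all `m`; isolated stage `0`; a finite `2`-basis dual frame of `κ(Ŝ₀)`).
-/

noncomputable section

set_option linter.dupNamespace false

open IsLocalRing MvPowerSeries
open Literature.AlgebraicGeometry.Resolution Literature.RingTheory.MvPowerSeries Literature.RingTheory.MvPowerSeries.monoidPowerSeries
open Literature.RingTheory.Derivation Literature.FieldTheory.Separability
open Summit.ResolutionOfSingularities.ResolutionOfSingularities.Theorems.SwitchingDichotomy
open Summit.ResolutionOfSingularities.ResolutionOfSingularities.Theorems.SwitchingDichotomy.ChartMonomialSubst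

namespace Summit.ResolutionOfSingularities.ResolutionOfSingularities.Theorems.SwitchingDichotomy.FreeChainHorizon

variable {L : Type} [Field L]

/-! ## Bookkeeping at a horizon -/

/-- Rationality of the steps `< M` iterates down to `S 0` for every stage `≤ M`. [folklore] -/
theorem exists_sub_mem_maximalIdeal_of_rational_le (S : ℕ → Subring L) [∀ m, IsLocalRing (S m)] (hle : ∀ m, S m ≤ S (m + 1))
    (hdom : ∀ m, SubringDominates (S m) (S (m + 1))) (M : ℕ)
    (hrat : ∀ m, m < M → ∀ z : S (m + 1), ∃ s : S m, z - Subring.inclusion (hle m) s ∈ maximalIdeal (S (m + 1))) :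
    ∀ m, m ≤ M → ∀ z : S m, ∃ s : S 0, z - Subring.inclusion (FreeChain.monotone S hle (Nat.zero_le m)) s ∈ maximalIdeal (S m) := by
  intro m
  induction m with
  | zero => intro _ z; exact ⟨z, by rw [show Subring.inclusion _ z = z from Subtype.ext rfl, sub_self]; exact zero_mem _⟩
  | succ m ih =>
    intro hm z
    obtain ⟨s₁, hs₁⟩ := hrat m (by omega) z
    obtain ⟨s₀, hs₀⟩ := ih (by omega) s₁
    refine ⟨s₀, ?_⟩
    have h2 : Subring.inclusion (hle m) (s₁ - Subring.inclusion (FreeChain.monotone S hle (Nat.zero_le m)) s₀) ∈ maximalIdeal (S (m + 1)) :=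
      FreeChain.inclusion_mem_maximalIdeal (hdom m) hs₀
    rw [map_sub, FreeChain.inclusion_inclusion S] at h2
    have := Ideal.add_mem _ hs₁ h2
    rwa [sub_add_sub_cancel] at this

/-- Persistence of the first exceptional parameter along the free steps `< M`, for every stage `≤ M`. [folklore] -/
theorem span_excParam_eq_of_free_le (S : ℕ → Subring L) (hle : ∀ m, S m ≤ S (m + 1)) (x : ∀ m, S (m + 1)) (u : S 0)
    (hx0 : Ideal.span {x 0} = Ideal.span {Subring.inclusion (hle 0) u}) (M : ℕ)
    (hfree : ∀ m, m < M → Ideal.span {Subring.inclusion (hle (m + 1)) (x m)} = Ideal.span {x (m + 1)}) :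
    ∀ m, m ≤ M → Ideal.span {x m} = Ideal.span {Subring.inclusion (FreeChain.monotone S hle (Nat.zero_le (m + 1))) u} := by
  intro m
  induction m with
  | zero => intro _; rw [hx0]
  | succ m ih =>
    intro hm
    rw [← hfree m (by omega)]
    have := congrArg (Ideal.map (Subring.inclusion (hle (m + 1)))) (ih (by omega))
    rwa [Ideal.map_span, Ideal.map_span, Set.image_singleton, Set.image_singleton, FreeChain.inclusion_inclusion S] at this

/-- **Free-chain coordinates at horizon `M`** (`FreeChain.exists_coordinates` with `𝔪_m S_{m+1} = (u)` and rationality only for `m < M`). [folklore] -/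
theorem exists_coordinates_lt (S : ℕ → Subring L) [∀ m, IsLocalRing (S m)] (hle : ∀ m, S m ≤ S (m + 1))
    (hqt : ∀ m, IsQuadraticTransform (S m) (S (m + 1))) (u : S 0) {ι : Type*} (w : ι → S 0)
    (hgen : Ideal.span (insert u (Set.range w)) = maximalIdeal (S 0)) (M : ℕ)
    (hmu : ∀ m, m < M → (maximalIdeal (S m)).map (Subring.inclusion (hle m)) =
      Ideal.span {Subring.inclusion (FreeChain.monotone S hle (Nat.zero_le (m + 1))) u})
    (hrat : ∀ m, m < M → ∀ z : S (m + 1), ∃ s : S m, z - Subring.inclusion (hle m) s ∈ maximalIdeal (S (m + 1))) :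
    ∃ (yt : ι → S 0) (wM : ι → S M),
      Ideal.span (insert u (Set.range yt)) = maximalIdeal (S 0) ∧
      Ideal.span (insert (Subring.inclusion (FreeChain.monotone S hle (Nat.zero_le M)) u) (Set.range wM)) = maximalIdeal (S M) ∧
      ∀ i, (yt i : L) = (u : L) ^ M * (wM i : L) := by
  have hdom : ∀ m, SubringDominates (S m) (S (m + 1)) := fun m => (hqt m).dominates
  induction M with
  | zero =>
    refine ⟨w, w, hgen, ?_, fun i => by rw [pow_zero, one_mul]⟩
    rw [show Subring.inclusion _ u = u from Subtype.ext rfl, hgen]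
  | succ M ih =>
    obtain ⟨yt, wM, hgen0, hgenM, hrel⟩ := ih (fun m hm => hmu m (by omega)) (fun m hm => hrat m (by omega))
    have hrat0 := exists_sub_mem_maximalIdeal_of_rational_le S hle hdom (M + 1) hrat
    have hratA : ∀ z : S (M + 1), ∃ s ∈ Set.range (Subring.inclusion (FreeChain.monotone S hle (Nat.zero_le M))),
        z - Subring.inclusion (hle M) s ∈ maximalIdeal (S (M + 1)) := by
      intro z
      obtain ⟨s₀, hs₀⟩ := hrat0 (M + 1) le_rfl z
      exact ⟨_, ⟨s₀, rfl⟩, by rwa [FreeChain.inclusion_inclusion S]⟩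
    obtain ⟨α, w', hαA, hαrel, hgen'⟩ :=
      FreeChain.exists_generators_of_rational_step (hqt M) (hle M) _ wM hgenM (hmu M (by omega)) _ hratA
    choose β hβ using hαA
    refine ⟨fun i => yt i - u ^ (M + 1) * β i, w', ?_, ?_, fun i => ?_⟩
    · rw [← hgen0]
      refine FreeChain.span_insert_eq_of_sub_mem u _ _ fun i => ?_
      rw [sub_sub_cancel_left, neg_mem_iff, pow_succ, mul_assoc]
      exact Ideal.mul_mem_left _ _ (Ideal.mul_mem_right _ _ (Ideal.mem_span_singleton_self u))
    · rwa [FreeChain.inclusion_inclusion S] at hgen'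
    · have e1 := hαrel i
      rw [← hβ i, Subring.coe_inclusion, Subring.coe_inclusion] at e1
      push_cast
      rw [hrel i, e1]
      ring

/-- **The law telescopes up to horizon `M`** (`FreeChain.exists_telescope` with `(x m) = (u)` only for `m < M`). [folklore] -/
theorem exists_telescope_lt [CharP L 2] (S : ℕ → Subring L) (hle : ∀ m, S m ≤ S (m + 1)) (f g : ∀ m, S m) (x : ∀ m, S (m + 1)) (u : S 0) (e : ℕ)
    (hlaw : ∀ m, ((f (m + 1) : S (m + 1)) : L) * ((x m : S (m + 1)) : L) ^ (2 * e) = ((f m : S m) : L) - ((g m : S m) : L) ^ 2) (M : ℕ)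
    (hxu : ∀ m, m < M → Ideal.span {x m} = Ideal.span {Subring.inclusion (FreeChain.monotone S hle (Nat.zero_le (m + 1))) u}) :
    ∃ Ψ E : S M, ((f 0 : S 0) : L) = (Ψ : L) ^ 2 + (u : L) ^ (2 * e * M) * (E : L) ^ 2 * ((f M : S M) : L) := by
  induction M with
  | zero => exact ⟨0, 1, by simp⟩
  | succ M ih =>
    obtain ⟨Ψ, E, hΨ⟩ := ih fun m hm => hxu m (by omega)
    obtain ⟨ε, hε⟩ := Ideal.mem_span_singleton'.mp ((hxu M (by omega)) ▸ Ideal.mem_span_singleton_self (x M))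
    have hεL : ((x M : S (M + 1)) : L) = (ε : L) * (u : L) := by
      have := congrArg (fun s : S (M + 1) => (s : L)) hε
      simpa [Subring.coe_inclusion] using this.symm
    have hM := hlaw M
    rw [hεL] at hM
    refine ⟨Subring.inclusion (hle M) Ψ + Subring.inclusion (FreeChain.monotone S hle (Nat.zero_le (M + 1))) u ^ (e * M) *
        Subring.inclusion (hle M) E * Subring.inclusion (hle M) (g M),
      Subring.inclusion (hle M) E * ε ^ e, ?_⟩
    push_cast [Subring.coe_inclusion]
    rw [CharTwo.add_sq, hΨ]
    have hfM : ((f M : S M) : L) = ((g M : S M) : L) ^ 2 + ((f (M + 1) : S (M + 1)) : L) * ((ε : L) * (u : L)) ^ (2 * e) := by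
      rw [hM]; ring
    rw [hfM]
    ring

/-- **Chain data at horizon `M`** (`FreeChainBound.exists_free_chain_data` with freeness and rationality only for the steps `< M`). [folklore] -/
theorem exists_free_chain_data_lt [CharP L 2] (e : ℕ) (S : ℕ → Subring L) [∀ m, IsLocalRing (S m)]
    (hle : ∀ m, S m ≤ S (m + 1)) (f g : ∀ m, S m) (x : ∀ m, S (m + 1))
    (hreg : ∀ m, IsRegularLocalRing (S m)) (hdim : ∀ m, ringKrullDim (S m) = (3 : ℕ))
    (hqt : ∀ m, IsQuadraticTransform (S m) (S (m + 1)))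
    (hspan : ∀ m, (maximalIdeal (S m)).map (Subring.inclusion (hle m)) = Ideal.span {x m})
    (hlaw : ∀ m, ((f (m + 1) : S (m + 1)) : L) * ((x m : S (m + 1)) : L) ^ (2 * e) = ((f m : S m) : L) - ((g m : S m) : L) ^ 2) (M : ℕ)
    (hfree : ∀ m, m < M → Ideal.span {Subring.inclusion (hle (m + 1)) (x m)} = Ideal.span {x (m + 1)})
    (hrat : ∀ m, m < M → ∀ z : S (m + 1), ∃ s : S m, z - Subring.inclusion (hle m) s ∈ maximalIdeal (S (m + 1))) :
    ∃ (u : S 0) (yt : Fin 2 → S 0) (wM : Fin 2 → S M) (Ψ E : S M),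
      Ideal.span (Set.range (Fin.cons u yt : Fin 3 → S 0)) = maximalIdeal (S 0) ∧
      Ideal.span (Set.range (Fin.cons (Subring.inclusion (FreeChain.monotone S hle (Nat.zero_le M)) u) wM : Fin 3 → S M)) = maximalIdeal (S M) ∧
      (∀ i, Subring.inclusion (FreeChain.monotone S hle (Nat.zero_le M)) (yt i) =
        Subring.inclusion (FreeChain.monotone S hle (Nat.zero_le M)) u ^ M * wM i) ∧
      Subring.inclusion (FreeChain.monotone S hle (Nat.zero_le M)) (f 0) =
        Ψ ^ 2 + Subring.inclusion (FreeChain.monotone S hle (Nat.zero_le M)) u ^ (M * (2 * e)) * (E ^ 2 * f M) ∧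
      ∀ z : S M, ∃ s : S 0, z - Subring.inclusion (FreeChain.monotone S hle (Nat.zero_le M)) s ∈ maximalIdeal (S M) := by
  classical
  haveI : ∀ m, IsRegularLocalRing (S m) := hreg
  -- adapted from Theorems/FrobeniusClosingSteerFreeChainBound.lean (`FreeChainBound.exists_free_chain_data`, this seat)
  have hfin0 : (maximalIdeal (S 0)).spanFinrank = 3 := by
    have h := IsRegularLocalRing.spanFinrank_maximalIdeal (R := S 0)
    rw [hdim 0] at h
    exact_mod_cast h
  obtain ⟨v₀, hv₀⟩ := exists_regularSystemOfParameters (R := S 0)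
  let v : Fin 3 → S 0 := fun i => v₀ (Fin.cast hfin0.symm i)
  have hv : Ideal.span (Set.range v) = maximalIdeal (S 0) := by
    rw [← hv₀]; congr 1; ext s; constructor
    · rintro ⟨i, rfl⟩; exact ⟨_, rfl⟩
    · rintro ⟨j, rfl⟩; exact ⟨Fin.cast hfin0 j, by simp [v]⟩
  obtain ⟨k, hk⟩ := FreeChain.exists_generator_eq_span (hle 0) v hv (x 0) (hspan 0)
  set u : S 0 := v k with hu
  let w : Fin 2 → S 0 := fun i => v (k.succAbove i)
  have hgen : Ideal.span (insert u (Set.range w)) = maximalIdeal (S 0) := by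
    rw [← hv]; congr 1
    ext s; simp only [Set.mem_insert_iff, Set.mem_range, w, hu]
    constructor
    · rintro (rfl | ⟨i, rfl⟩); exacts [⟨k, rfl⟩, ⟨_, rfl⟩]
    · rintro ⟨j, rfl⟩
      by_cases hj : j = k
      · exact Or.inl (by rw [hj])
      · obtain ⟨i, rfl⟩ := Fin.exists_succAbove_eq hj
        exact Or.inr ⟨i, rfl⟩
  have hxu := span_excParam_eq_of_free_le S hle x u hk M hfree
  have hmu : ∀ m, m < M → (maximalIdeal (S m)).map (Subring.inclusion (hle m)) =
      Ideal.span {Subring.inclusion (FreeChain.monotone S hle (Nat.zero_le (m + 1))) u} := fun m hm => (hspan m).trans (hxu m (by omega))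
  obtain ⟨yt, wM, hgen0, hgenM, hrel⟩ := exists_coordinates_lt S hle hqt u w hgen M hmu hrat
  obtain ⟨Ψ, E, hΨ⟩ := exists_telescope_lt S hle f g x u e hlaw M (fun m hm => hxu m (by omega))
  have hdom : ∀ m, SubringDominates (S m) (S (m + 1)) := fun m => (hqt m).dominates
  have hrat0 := exists_sub_mem_maximalIdeal_of_rational_le S hle hdom M hrat
  refine ⟨u, yt, wM, Ψ, E, ?_, ?_, fun i => Subtype.ext ?_, Subtype.ext ?_, hrat0 M le_rfl⟩
  · rw [Fin.range_cons]; exact hgen0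
  · rw [Fin.range_cons]; exact hgenM
  · rw [Subring.coe_inclusion, hrel i, Subring.coe_mul, Subring.coe_pow, Subring.coe_inclusion]
  · simp only [Subring.coe_inclusion, Subring.coe_add, Subring.coe_mul, Subring.coe_pow]
    rw [hΨ]; ring

/-! ## The bound at a horizon -/

variable [CharP L 2]

/-- **Lemma F♭_λ at horizon `M` (no perfectness).** `FreeChainBoundPBasis.milnorLengthPlus_completion_ge` with FREENESS and RATIONALITY assumed only for the
steps `< M`: then `M − 1 ≤ ℓ(Ŝ₀ ⧸ 𝒥_abs(f̂₀)) < ∞`. [folklore] -/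
theorem milnorLengthPlus_completion_ge_of_lt (e : ℕ) (he : 1 ≤ e) (S : ℕ → Subring L) [∀ m, IsLocalRing (S m)]
    (hle : ∀ m, S m ≤ S (m + 1)) (f g : ∀ m, S m) (x : ∀ m, S (m + 1))
    (hreg : ∀ m, IsRegularLocalRing (S m)) (hexc : IsExcellentRing (S 0)) (hdim : ∀ m, ringKrullDim (S m) = (3 : ℕ))
    (hqt : ∀ m, IsQuadraticTransform (S m) (S (m + 1)))
    (hspan : ∀ m, (maximalIdeal (S m)).map (Subring.inclusion (hle m)) = Ideal.span {x m})
    (hlaw : ∀ m, ((f (m + 1) : S (m + 1)) : L) * ((x m : S (m + 1)) : L) ^ (2 * e) = ((f m : S m) : L) - ((g m : S m) : L) ^ 2)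
    (hiso : ∀ (P : Ideal (AdjoinRoot ((Polynomial.X : Polynomial (S 0)) ^ 2 - Polynomial.C (f 0)))) [P.IsPrime],
      (∃ Q : Ideal (AdjoinRoot ((Polynomial.X : Polynomial (S 0)) ^ 2 - Polynomial.C (f 0))), Q.IsPrime ∧ P < Q) →
        IsRegularLocalRing (Localization.AtPrime P))
    [CharP (ResidueField (AdicCompletion (maximalIdeal (S 0)) (S 0))) 2]
    {r : ℕ} (γ : Fin r → ResidueField (AdicCompletion (maximalIdeal (S 0)) (S 0)))
    (D : Fin r → Derivation ℤ (ResidueField (AdicCompletion (maximalIdeal (S 0)) (S 0))) (ResidueField (AdicCompletion (maximalIdeal (S 0)) (S 0))))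
    (hdual : ∀ l l', D l (γ l') = if l' = l then 1 else 0) (hgen : pAdjoin 2 (Set.range γ) = ⊤)
    {M : ℕ} (hM : 1 ≤ M)
    (hfree : ∀ m, m < M → Ideal.span {Subring.inclusion (hle (m + 1)) (x m)} = Ideal.span {x (m + 1)})
    (hrat : ∀ m, m < M → ∀ z : S (m + 1), ∃ s : S m, z - Subring.inclusion (hle m) s ∈ maximalIdeal (S (m + 1))) :
    ((M - 1 : ℕ) : ℕ∞) ≤ Module.length (AdicCompletion (maximalIdeal (S 0)) (S 0)) (AdicCompletion (maximalIdeal (S 0)) (S 0) ⧸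
        Ideal.span (Set.range fun Dv : Derivation ℤ (AdicCompletion (maximalIdeal (S 0)) (S 0)) (AdicCompletion (maximalIdeal (S 0)) (S 0)) =>
          Dv (algebraMap (S 0) (AdicCompletion (maximalIdeal (S 0)) (S 0)) (f 0)))) ∧
      Module.length (AdicCompletion (maximalIdeal (S 0)) (S 0)) (AdicCompletion (maximalIdeal (S 0)) (S 0) ⧸
        Ideal.span (Set.range fun Dv : Derivation ℤ (AdicCompletion (maximalIdeal (S 0)) (S 0)) (AdicCompletion (maximalIdeal (S 0)) (S 0)) =>
          Dv (algebraMap (S 0) (AdicCompletion (maximalIdeal (S 0)) (S 0)) (f 0)))) < ⊤ := by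
  classical
  haveI : ∀ m, IsRegularLocalRing (S m) := hreg
  haveI : Fact (Nat.Prime 2) := ⟨Nat.prime_two⟩
  obtain ⟨u, yt, wM, Ψ, E, hgen0, hgenM, hrel, hΨ, hrat0⟩ :=
    exists_free_chain_data_lt e S hle f g x hreg hdim hqt hspan hlaw M hfree hrat
  have hwM : ∀ k, wM k ∈ maximalIdeal (S M) := fun k => by
    rw [← hgenM]; exact Ideal.subset_span ⟨k.succ, Fin.cons_succ _ _ _⟩
  have huM : Subring.inclusion (FreeChain.monotone S hle (Nat.zero_le M)) u ∈ maximalIdeal (S M) := by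
    rw [← hgenM]; exact Ideal.subset_span ⟨0, Fin.cons_zero _ _⟩
  -- ### nested frames along `S 0 → S M`, the free substitution read exactly
  obtain ⟨frameS, frameT, ρ, hfSx, -, hfTx, -, hsq⟩ := NestedFrames.exists_nested_frames 2
    (Subring.inclusion (FreeChain.monotone S hle (Nat.zero_le M)))
    (by
      rw [← hgen0, Ideal.map_span, Ideal.span_le]
      rintro _ ⟨_, ⟨i, rfl⟩, rfl⟩
      refine Fin.cases ?_ (fun k => ?_) i
      · rw [Fin.cons_zero]; exact huM
      · rw [Fin.cons_succ, hrel]; exact Ideal.mul_mem_left _ _ (hwM k))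
    hrat0 (hdim 0) (hdim M) (Fin.cons u yt) hgen0 (Fin.cons (Subring.inclusion (FreeChain.monotone S hle (Nat.zero_le M)) u) wM) hgenM
    (fun i : Fin 3 => Finsupp.single i 1 + if i = 0 then 0 else M • Finsupp.single 0 1) (chartExp_ne_zero 0 M)
    (fun i => by
      rw [FreeChainBoundPBasis.prod_pow_chartExp]
      refine Fin.cases ?_ (fun k => ?_) i
      · rw [if_pos rfl, Fin.cons_zero, Fin.cons_zero]
      · rw [if_neg (Fin.succ_ne_zero k), Fin.cons_succ, Fin.cons_zero, Fin.cons_succ, hrel])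
  -- ### the reading `θ_M F = Ψ'² + X₀^(M·2e) G'`
  have hfT0 : frameT (algebraMap (S M) _ (Subring.inclusion (FreeChain.monotone S hle (Nat.zero_le M)) u)) = X 0 := by
    have := hfTx 0; rwa [Fin.cons_zero] at this
  have hread := hsq (f 0)
  rw [hΨ] at hread
  simp only [map_add, map_mul, map_pow, hfT0] at hread
  have hθ := FreeChainBoundPBasis.eq_sq_add_of_map_eq ρ hread.symm
  -- ### `M − 1 ≤ τ⁺(F) < ∞`
  have hge := G3Perf.milnorLengthPlus_ge_of_substGenerators_eq D (by omega : 2 ≤ 2 * e) hM hθ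
  have hfin := IsolatedColength.length_quotient_span_jacobian_lt_top_of_isolated 2 hexc (f 0) hiso frameS γ D hdual hgen
  -- ### intrinsic form (compose by `trans_eq`: the instance paths of `Derivation ℤ` / `Field κ(Ŝ₀)` differ between the generic lemmas)
  have key := FreeChainBoundPBasis.span_derivation_eq_span_jacobian 2 γ D hdual hgen (frameS (algebraMap (S 0) (AdicCompletion (maximalIdeal (S 0)) (S 0)) (f 0)))
  have hge2 := hge.trans_eq (congrArg (fun J => Module.length (MvPowerSeries (Fin 3) (ResidueField (AdicCompletion (maximalIdeal (S 0)) (S 0))))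
    (MvPowerSeries (Fin 3) (ResidueField (AdicCompletion (maximalIdeal (S 0)) (S 0))) ⧸ J)) key.symm)
  have hfin2 := (congrArg (fun J => Module.length (MvPowerSeries (Fin 3) (ResidueField (AdicCompletion (maximalIdeal (S 0)) (S 0))))
    (MvPowerSeries (Fin 3) (ResidueField (AdicCompletion (maximalIdeal (S 0)) (S 0))) ⧸ J)) key).trans_lt hfin
  have htransport := JacobianLength.length_quotient_jacobian_eq_of_ringEquiv frameS (algebraMap (S 0) (AdicCompletion (maximalIdeal (S 0)) (S 0)) (f 0))
  have hrange : ∀ (i₁ i₂ : Algebra ℤ (MvPowerSeries (Fin 3) (ResidueField (AdicCompletion (maximalIdeal (S 0)) (S 0)))))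
      (b : MvPowerSeries (Fin 3) (ResidueField (AdicCompletion (maximalIdeal (S 0)) (S 0)))),
      (Set.range fun Dv : @Derivation ℤ (MvPowerSeries (Fin 3) (ResidueField (AdicCompletion (maximalIdeal (S 0)) (S 0))))
          (MvPowerSeries (Fin 3) (ResidueField (AdicCompletion (maximalIdeal (S 0)) (S 0)))) _ _ _ i₁ _ _ => Dv b) =
        Set.range fun Dv : @Derivation ℤ (MvPowerSeries (Fin 3) (ResidueField (AdicCompletion (maximalIdeal (S 0)) (S 0))))
          (MvPowerSeries (Fin 3) (ResidueField (AdicCompletion (maximalIdeal (S 0)) (S 0)))) _ _ _ i₂ _ _ => Dv b := by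
    intro i₁ i₂ b
    obtain rfl : i₁ = i₂ := Algebra.algebra_ext _ _ fun r => (eq_intCast _ r).trans (eq_intCast _ r).symm
    rfl
  have hK := congrArg (fun s => Module.length (MvPowerSeries (Fin 3) (ResidueField (AdicCompletion (maximalIdeal (S 0)) (S 0))))
    (MvPowerSeries (Fin 3) (ResidueField (AdicCompletion (maximalIdeal (S 0)) (S 0))) ⧸ Ideal.span s))
    (hrange (MvPowerSeries.instAlgebra) (Ring.toIntAlgebra _) (frameS (algebraMap (S 0) (AdicCompletion (maximalIdeal (S 0)) (S 0)) (f 0))))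
  exact ⟨(hge2.trans_eq hK).trans htransport.le, htransport.symm.trans_lt (hK.symm.trans_lt hfin2)⟩

end Summit.ResolutionOfSingularities.ResolutionOfSingularities.Theorems.SwitchingDichotomy.FreeChainHorizon

end
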